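import Literature.InformationTheory.QuantumCodes.CodeCapacityNoise
import HarnessLib

/-!
# The threshold REGION of a two-rate noise model (`p` = qubit-error rate, `q` = measurement-error rate)

Topic `Literature/InformationTheory/QuantumCodes` (venture QEC, LADDER-QEC rung Q5, PARTITION row 09 "the THRESHOLD definition
for (family, decoder, noise)"; qec-type-09 gen 4, item 09.ANISO). `CodeCapacityNoise.lean` types the one-parameter notions
`BelowThreshold P p`, `IsThresholdLowerBound P p₀`, `accuracyThreshold P` for failure families `P : ℕ → ℝ → ℝ`. The
phenomenological model has TWO rates and its threshold is a REGION of the `(p, q)`-plane: "Provided that `p̃ < (4μ₃²)⁻¹`,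
`q̃ < (4μ₃²)⁻¹` … the accuracy threshold is surely attained provided that … `p, q < .0114`" (Dennis–Kitaev–Landahl–Preskill
§5.3 eqs. (threshold_iso), (threshold_iso_num)). This file types the vocabulary used by the two-rate theorems
(`ToricCodePhenomenologicalAnisotropic.lean`, `CSSPhenomenologicalAnisotropic.lean`) — definitions REAL, lemmas PROVED:

* `BelowThreshold₂ P p q` — the failure family `P : ℕ → ℝ → ℝ → ℝ` tends to `0` at the rate pair `(p, q)`;
* `IsThresholdBoxLowerBound P ρ₀` — every pair with `0 ≤ p, q < ρ₀` is below threshold (a certified SQUARE inside the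
  threshold region); `IsThresholdBoxLowerBound.mono`, `.of_forall_le` (the form the two-rate theorems produce),
  `.diagonal` (restricting to `q = p` gives a one-parameter `IsThresholdLowerBound`), `.le_accuracyThreshold_diagonal`.

## References
* [DennisEtAl2002] E. Dennis, A. Kitaev, A. Landahl, J. Preskill, *Topological quantum memory*, J. Math. Phys. 43
  (2002) 4452–4505, arXiv:quant-ph/0110143, §4.2 (rates p, q), §5.3 eqs. (threshold_iso), (threshold_iso_num).
-/

namespace Literature.InformationTheory.QuantumCodes

open Filter Topology

section TwoRate

variable (P : ℕ → ℝ → ℝ → ℝ)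

/-- **Below threshold at the rate pair `(p, q)`**: the failure probability of the size-`L` member tends to `0`.
(definition) [cite: DennisEtAl2002, §5.3 eq. (threshold_iso) (Prob_fail → 0 for p̃, q̃ < (4μ₃²)⁻¹)] -/
def BelowThreshold₂ (p q : ℝ) : Prop :=
  Tendsto (fun L => P L p q) atTop (𝓝 0)

/-- `ρ₀` is a **lower bound on the threshold box**: every rate pair with `0 ≤ p < ρ₀`, `0 ≤ q < ρ₀` is below
threshold ("the accuracy threshold is surely attained provided that … `p, q < .0114`"). (definition)
[cite: DennisEtAl2002, §5.3 eq. (threshold_iso_num) (p, q < .0114)] -/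
def IsThresholdBoxLowerBound (ρ₀ : ℝ) : Prop :=
  ∀ p q : ℝ, 0 ≤ p → 0 ≤ q → p < ρ₀ → q < ρ₀ → BelowThreshold₂ P p q

variable {P}

/-- A smaller box is certified by a larger one. [cite: DennisEtAl2002, §5.3 eq. (threshold_iso_num)] -/
theorem IsThresholdBoxLowerBound.mono {ρ₀ ρ₁ : ℝ} (h : IsThresholdBoxLowerBound P ρ₀) (hle : ρ₁ ≤ ρ₀) :
    IsThresholdBoxLowerBound P ρ₁ :=
  fun p q hp hq hp' hq' => h p q hp hq (lt_of_lt_of_le hp' hle) (lt_of_lt_of_le hq' hle)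

/-- **The shape produced by the two-rate theorems**: if `P → 0` whenever `0 ≤ p, q ≤ ρ` for some `ρ < ρ₀` with
`0 ≤ ρ`, then `ρ₀` bounds the threshold box. [cite: DennisEtAl2002, §5.3 eq. (threshold_iso)] -/
theorem IsThresholdBoxLowerBound.of_forall_le {ρ₀ : ℝ}
    (h : ∀ p q ρ : ℝ, 0 ≤ p → 0 ≤ q → p ≤ ρ → q ≤ ρ → ρ < ρ₀ → BelowThreshold₂ P p q) :
    IsThresholdBoxLowerBound P ρ₀ :=
  fun p q hp hq hp' hq' => h p q (max p q) hp hq (le_max_left p q) (le_max_right p q) (max_lt hp' hq')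

/-- **The diagonal**: a threshold box bound is a one-parameter threshold lower bound for the isotropic family
`q = p` (the tree's `IsThresholdLowerBound`). [cite: DennisEtAl2002, §5.3 ("Eq. (threshold_iso_num) bounds the accuracy threshold in the case p = q")] -/
theorem IsThresholdBoxLowerBound.diagonal {ρ₀ : ℝ} (h : IsThresholdBoxLowerBound P ρ₀) :
    IsThresholdLowerBound (fun L p => P L p p) ρ₀ :=
  fun p hp hp' => h p p hp hp hp' hp'

/-- Along any horizontal line `q = q₀` with `0 ≤ q₀ < ρ₀`, the box bound is a one-parameter threshold lower bound
in `p`. [cite: DennisEtAl2002, §4.2 (p and q as independent parameters)] -/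
theorem IsThresholdBoxLowerBound.slice_q {ρ₀ q₀ : ℝ} (h : IsThresholdBoxLowerBound P ρ₀) (hq0 : 0 ≤ q₀)
    (hq : q₀ < ρ₀) : IsThresholdLowerBound (fun L p => P L p q₀) ρ₀ :=
  fun p hp hp' => h p q₀ hp hq0 hp' hq

/-- Along any vertical line `p = p₀'` with `0 ≤ p₀' < ρ₀`, the box bound is a one-parameter threshold lower bound in
the measurement-error rate `q`. [cite: DennisEtAl2002, §4.2 (p and q as independent parameters)] -/
theorem IsThresholdBoxLowerBound.slice_p {ρ₀ p₁ : ℝ} (h : IsThresholdBoxLowerBound P ρ₀) (hp0 : 0 ≤ p₁)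
    (hp : p₁ < ρ₀) : IsThresholdLowerBound (fun L q => P L p₁ q) ρ₀ :=
  fun q hq hq' => h p₁ q hp0 hq hp hq'

/-- Consequently a box bound `ρ₀ ≤ 1` is a lower bound on the (one-parameter) accuracy threshold of the diagonal
family. [cite: DennisEtAl2002, §5.3 eq. (threshold_iso_num)] -/
theorem IsThresholdBoxLowerBound.mem_thresholdLowerBounds_diagonal {ρ₀ : ℝ} (h : IsThresholdBoxLowerBound P ρ₀)
    (hρ : ρ₀ ≤ 1) : ρ₀ ∈ thresholdLowerBounds (fun L p => P L p p) :=
  ⟨hρ, h.diagonal⟩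

end TwoRate

end Literature.InformationTheory.QuantumCodes
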